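import Mathlib
import Summits.Schanuel.Schanuel.Theorems.RigidCoreMinimalCounterexampleInAclHitSetBoxArithComplex

/-!
# Zeros of continuous functions in rational boxes, inside first-order arithmetic; ring-definable constants
# (crux stmt-Schanuel-0969 `RigidCore.MinimalCounterexampleInAcl`, line kernel-arithmetic-selection, stub S8‴)

`--supports stmt-Schanuel-0969`; foundation layer under `stub_corankOne_hitSetRingDefinable` (S8‴).  The presentation of the hit
pattern (`…HitSetIsolation.lean`) speaks of ZEROS OF CONTINUOUS FUNCTIONS IN CLOSED RATIONAL BOXES.  Here such statements are
made first-order over `ℤ`: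

* `exists_zero_in_box_iff` (analysis): a continuous `g ≥ 0` has a zero in the closed rational box `B` iff for every `n` some
  GAUSSIAN-RATIONAL point `q ∈ B` has `g q < 1/(n+1)` (compactness of `B` one way, density of `ℚ[i] ∩ B` in `B` the other);
* `ringDefinable_setOf_existsZeroInBox`: hence, if the values of `g_v` at Gaussian rationals form a ring-definable real family
  (in the sense of `…HitSetBoxArith.lean`: ring-definable strict lower rational cut) and the box corners are ring-definable
  rational functions of `v`, then `{v | ∃ z ∈ B_v, g_v z = 0}` is ring-definable;
* `defR_substitute` / `defC_substitute`: substitution of ring-definable integer maps into ring-definable families.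

Isolated zeros as ring-definable constants (algebraic numbers, `2πi`, logarithms of algebraic numbers) follow in
`…HitSetConstants.lean`.

Registered helper stub: `ringDefinable_existsZeroInBox_fin` (explicit `Fin k`-parameter form).

References: K. Weihrauch, *Computable Analysis* (2000), §6.3 (zero sets of continuous functions); H. Rogers (1967), §15.1.
-/

-- the summit namespace `Summit.Schanuel.Schanuel.…` repeats a component by design (D-0022)
set_option linter.dupNamespace false

open Set FirstOrder FirstOrder.Language Filter Topology

namespace Summit.Schanuel.Schanuel.Cruxes.MinimalCounterexampleInAcl.KernelArithmeticSelection

open Literature.ModelTheory.ExponentialFields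

/-! ## Analysis: zeros in a closed rational box through Gaussian-rational test points -/

/-- A rational point of a closed rational interval within `δ` of a given point of the interval. -/
theorem exists_rat_near_mem_Icc {lo hi : ℚ} {t : ℝ} (h1 : (lo : ℝ) ≤ t) (h2 : t ≤ hi) {δ : ℝ} (hδ : 0 < δ) :
    ∃ q : ℚ, lo ≤ q ∧ q ≤ hi ∧ |(q : ℝ) - t| < δ := by
  rcases h1.lt_or_eq with hlt | heq
  · obtain ⟨q, hq1, hq2⟩ := exists_rat_btwn (max_lt hlt (sub_lt_self t hδ))
    refine ⟨q, by exact_mod_cast (le_max_left _ _).trans hq1.le, by exact_mod_cast (hq2.le.trans h2), ?_⟩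
    rw [abs_sub_lt_iff]; constructor <;> linarith [le_max_right (lo : ℝ) (t - δ)]
  · exact ⟨lo, le_rfl, by exact_mod_cast (h1.trans h2), by rw [heq, sub_self, abs_zero]; exact hδ⟩

/-- **Zeros in a box through test points.**  A continuous non-negative `g : ℂ → ℝ` vanishes somewhere in the closed rational
box `[lo₁, hi₁] × [lo₂, hi₂]` iff for every `n` some Gaussian-rational point of the box has `g < 1/(n+1)` (⇒: density and
continuity; ⇐: compactness). [folklore] -/
theorem exists_zero_in_box_iff {g : ℂ → ℝ} (hg : Continuous g) (hg0 : ∀ z, 0 ≤ g z) (lo₁ hi₁ lo₂ hi₂ : ℚ) :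
    (∃ z : ℂ, ((lo₁ : ℝ) ≤ z.re ∧ z.re ≤ hi₁ ∧ (lo₂ : ℝ) ≤ z.im ∧ z.im ≤ hi₂) ∧ g z = 0) ↔
      ∀ n : ℕ, ∃ q₁ q₂ : ℚ, (lo₁ ≤ q₁ ∧ q₁ ≤ hi₁ ∧ lo₂ ≤ q₂ ∧ q₂ ≤ hi₂) ∧ g ⟨q₁, q₂⟩ < 1 / (n + 1) := by
  constructor
  · rintro ⟨z, ⟨h1, h2, h3, h4⟩, hz⟩ n
    obtain ⟨δ, hδ, hδ'⟩ := Metric.continuous_iff.1 hg z (1 / (n + 1)) (by positivity)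
    obtain ⟨q₁, hq1, hq1', hq1''⟩ := exists_rat_near_mem_Icc h1 h2 (half_pos hδ)
    obtain ⟨q₂, hq2, hq2', hq2''⟩ := exists_rat_near_mem_Icc h3 h4 (half_pos hδ)
    refine ⟨q₁, q₂, ⟨hq1, hq1', hq2, hq2'⟩, ?_⟩
    have hd : dist (⟨q₁, q₂⟩ : ℂ) z < δ := by
      rw [Complex.dist_eq]
      calc ‖(⟨q₁, q₂⟩ : ℂ) - z‖ ≤ |((⟨q₁, q₂⟩ : ℂ) - z).re| + |((⟨q₁, q₂⟩ : ℂ) - z).im| :=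
            Complex.norm_le_abs_re_add_abs_im _
        _ < δ / 2 + δ / 2 := add_lt_add (by simpa using hq1'') (by simpa using hq2'')
        _ = δ := by ring
    have := hδ' _ hd
    rw [hz, Real.dist_eq, sub_zero, abs_of_nonneg (hg0 _)] at this
    exact this
  · intro h
    choose q₁ q₂ hq using h
    set K : Set ℂ := {z : ℂ | (lo₁ : ℝ) ≤ z.re ∧ z.re ≤ hi₁ ∧ (lo₂ : ℝ) ≤ z.im ∧ z.im ≤ hi₂} with hK
    have hKc : IsCompact K := by
      rw [Metric.isCompact_iff_isClosed_bounded]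
      constructor
      · simp only [hK, setOf_and]
        exact (isClosed_le continuous_const Complex.continuous_re).inter
          ((isClosed_le Complex.continuous_re continuous_const).inter
          ((isClosed_le continuous_const Complex.continuous_im).inter
          (isClosed_le Complex.continuous_im continuous_const)))
      · rw [isBounded_iff_forall_norm_le]
        refine ⟨|(lo₁ : ℝ)| + |(hi₁ : ℝ)| + (|(lo₂ : ℝ)| + |(hi₂ : ℝ)|), fun z hz => ?_⟩
        obtain ⟨h1, h2, h3, h4⟩ := hz
        refine (Complex.norm_le_abs_re_add_abs_im z).trans (add_le_add ?_ ?_)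
        · rw [abs_le]; constructor <;> linarith [neg_abs_le (lo₁ : ℝ), le_abs_self (hi₁ : ℝ), abs_nonneg (lo₁ : ℝ),
            abs_nonneg (hi₁ : ℝ)]
        · rw [abs_le]; constructor <;> linarith [neg_abs_le (lo₂ : ℝ), le_abs_self (hi₂ : ℝ), abs_nonneg (lo₂ : ℝ),
            abs_nonneg (hi₂ : ℝ)]
    have hmem : ∀ n, (⟨q₁ n, q₂ n⟩ : ℂ) ∈ K := fun n => by
      obtain ⟨⟨h1, h2, h3, h4⟩, -⟩ := hq n
      exact ⟨show (lo₁ : ℝ) ≤ (q₁ n : ℝ) by exact_mod_cast h1, show ((q₁ n : ℝ)) ≤ hi₁ by exact_mod_cast h2,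
        show (lo₂ : ℝ) ≤ (q₂ n : ℝ) by exact_mod_cast h3, show ((q₂ n : ℝ)) ≤ hi₂ by exact_mod_cast h4⟩
    obtain ⟨a, haK, φ, hφ, hlim⟩ := hKc.tendsto_subseq hmem
    refine ⟨a, haK, ?_⟩
    have h1 : Tendsto (fun n => g (⟨q₁ (φ n), q₂ (φ n)⟩ : ℂ)) atTop (𝓝 (g a)) := (hg.tendsto a).comp hlim
    have h2 : Tendsto (fun n => g (⟨q₁ (φ n), q₂ (φ n)⟩ : ℂ)) atTop (𝓝 0) := by
      refine tendsto_of_tendsto_of_tendsto_of_le_of_le tendsto_const_nhds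
        (tendsto_one_div_add_atTop_nhds_zero_nat (𝕜 := ℝ)) (fun n => hg0 _) (fun n => ?_)
      exact (hq (φ n)).2.le.trans (Nat.one_div_le_one_div (hφ.id_le n))
    exact tendsto_nhds_unique h1 h2

/-- Gaussian rationals as integer triples: `q₁ + q₂ i = (a + b i)/c` with `0 < c`. -/
theorem exists_int_triple_eq (q₁ q₂ : ℚ) : ∃ a b c : ℤ, 0 < c ∧ (q₁ : ℝ) = a / c ∧ (q₂ : ℝ) = b / c := by
  refine ⟨q₁.num * q₂.den, q₂.num * q₁.den, q₁.den * q₂.den, by positivity, ?_, ?_⟩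
  · push_cast
    rw [mul_div_mul_right _ _ (by positivity : ((q₂.den : ℝ)) ≠ 0)]
    exact_mod_cast (Rat.num_div_den q₁).symm
  · push_cast
    rw [mul_comm ((q₁.den : ℝ)) _, mul_div_mul_right _ _ (by positivity : ((q₁.den : ℝ)) ≠ 0)]
    exact_mod_cast (Rat.num_div_den q₂).symm

/-- The test point `(a + b i)/c` as a pair of real coordinates. -/
theorem testPoint_eq (a b c : ℤ) :
    ((a : ℂ) + (b : ℂ) * Complex.I) / (c : ℂ) = ⟨(a : ℝ) / (c : ℝ), (b : ℝ) / (c : ℝ)⟩ := by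
  rw [← Complex.ofReal_intCast c]
  apply Complex.ext
  · rw [Complex.div_ofReal_re]; simp
  · rw [Complex.div_ofReal_im]; simp

variable [FirstOrder.Ring.CompatibleRing ℤ] {σ τ : Type*}

/-! ## Substitution -/

/-- Substituting a ring-definable map of parameters into a ring-definable real family. [folklore] -/
theorem defR_substitute [Finite σ] {f : (σ → ℤ) → ℝ} (hf : (∅ : Set ℤ).Definable Language.ring {w : _ ⊕ Fin 2 → ℤ | 0 < w (Sum.inr 1) ∧ ((w (Sum.inr 0) : ℤ) : ℝ) < ((w (Sum.inr 1) : ℤ) : ℝ) * (f ∘ fun w' s => w' (Sum.inl s)) w}) {F : (τ → ℤ) → σ → ℤ}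
    (hF : (∅ : Set ℤ).DefinableMap Language.ring F) : (∅ : Set ℤ).Definable Language.ring {w : _ ⊕ Fin 2 → ℤ | 0 < w (Sum.inr 1) ∧ ((w (Sum.inr 0) : ℤ) : ℝ) < ((w (Sum.inr 1) : ℤ) : ℝ) * ((fun u : τ → ℤ => f (F u)) ∘ fun w' s => w' (Sum.inl s)) w} := by
  have hG : (∅ : Set ℤ).DefinableMap Language.ring
      (fun u : τ ⊕ Fin 2 → ℤ => (Sum.elim (F (fun s => u (Sum.inl s))) (fun i => u (Sum.inr i)) : σ ⊕ Fin 2 → ℤ)) := by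
    rintro (s | i)
    · exact definableFun_reindex (hF s) Sum.inl
    · exact definableFun_proj_params (L := Language.ring) (A := (∅ : Set ℤ)) (α := τ ⊕ Fin 2) (Sum.inr i)
  have h := hf.preimage_map hG
  convert h using 1
  ext u
  simp only [mem_setOf_eq, mem_preimage, Function.comp_apply, Sum.elim_inl, Sum.elim_inr]

/-- Substituting a ring-definable map of parameters into a ring-definable complex family. [folklore] -/
theorem defC_substitute [Finite σ] {f : (σ → ℤ) → ℂ} (hf : ((∅ : Set ℤ).Definable Language.ring {w : _ ⊕ Fin 2 → ℤ | 0 < w (Sum.inr 1) ∧ ((w (Sum.inr 0) : ℤ) : ℝ) < ((w (Sum.inr 1) : ℤ) : ℝ) * ((Complex.re ∘ f) ∘ fun w' s => w' (Sum.inl s)) w} ∧ (∅ : Set ℤ).Definable Language.ring {w : _ ⊕ Fin 2 → ℤ | 0 < w (Sum.inr 1) ∧ ((w (Sum.inr 0) : ℤ) : ℝ) < ((w (Sum.inr 1) : ℤ) : ℝ) * ((Complex.im ∘ f) ∘ fun w' s => w' (Sum.inl s)) w})) {F : (τ → ℤ) → σ → ℤ}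
    (hF : (∅ : Set ℤ).DefinableMap Language.ring F) : ((∅ : Set ℤ).Definable Language.ring {w : _ ⊕ Fin 2 → ℤ | 0 < w (Sum.inr 1) ∧ ((w (Sum.inr 0) : ℤ) : ℝ) < ((w (Sum.inr 1) : ℤ) : ℝ) * ((Complex.re ∘ (fun u : τ → ℤ => f (F u))) ∘ fun w' s => w' (Sum.inl s)) w} ∧ (∅ : Set ℤ).Definable Language.ring {w : _ ⊕ Fin 2 → ℤ | 0 < w (Sum.inr 1) ∧ ((w (Sum.inr 0) : ℤ) : ℝ) < ((w (Sum.inr 1) : ℤ) : ℝ) * ((Complex.im ∘ (fun u : τ → ℤ => f (F u))) ∘ fun w' s => w' (Sum.inl s)) w}) :=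
  ⟨defR_substitute hf.1 hF, defR_substitute hf.2 hF⟩

/-! ## `∃ z ∈ box, g z = 0` is a ring-definable condition -/

/-- **Zeros in boxes, first order over `ℤ`.**  Let `g_v : ℂ → ℝ` (`v ∈ ℤ^σ`) be continuous and non-negative, with
`(v, a, b, c) ↦ g_v ((a + bi)/c)` a ring-definable real family, and let `lo₁, hi₁, lo₂, hi₂, den` be ring-definable integer
functions.  Then `{v | 0 < den v ∧ ∃ z ∈ [lo₁/den, hi₁/den] × [lo₂/den, hi₂/den], g_v z = 0}` is ring-definable
(`exists_zero_in_box_iff`). [folklore] -/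
theorem ringDefinable_setOf_existsZeroInBox (g : (σ → ℤ) → ℂ → ℝ) (hcont : ∀ v, Continuous (g v))
    (hnn : ∀ v z, 0 ≤ g v z)
    (hdef : (∅ : Set ℤ).Definable Language.ring {w : _ ⊕ Fin 2 → ℤ | 0 < w (Sum.inr 1) ∧ ((w (Sum.inr 0) : ℤ) : ℝ) < ((w (Sum.inr 1) : ℤ) : ℝ) * ((fun w : σ ⊕ Fin 3 → ℤ => g (fun s => w (Sum.inl s))
      ((((w (Sum.inr 0) : ℤ) : ℂ) + ((w (Sum.inr 1) : ℤ) : ℂ) * Complex.I) / ((w (Sum.inr 2) : ℤ) : ℂ))) ∘ fun w' s => w' (Sum.inl s)) w})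
    {lo₁ hi₁ lo₂ hi₂ den : (σ → ℤ) → ℤ} (hlo₁ : (∅ : Set ℤ).DefinableFun Language.ring lo₁)
    (hhi₁ : (∅ : Set ℤ).DefinableFun Language.ring hi₁) (hlo₂ : (∅ : Set ℤ).DefinableFun Language.ring lo₂)
    (hhi₂ : (∅ : Set ℤ).DefinableFun Language.ring hi₂) (hden : (∅ : Set ℤ).DefinableFun Language.ring den) :
    (∅ : Set ℤ).Definable Language.ring {v : σ → ℤ | 0 < den v ∧ ∃ z : ℂ,
      (((lo₁ v : ℤ) : ℝ) / ((den v : ℤ) : ℝ) ≤ z.re ∧ z.re ≤ ((hi₁ v : ℤ) : ℝ) / ((den v : ℤ) : ℝ) ∧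
        ((lo₂ v : ℤ) : ℝ) / ((den v : ℤ) : ℝ) ≤ z.im ∧ z.im ≤ ((hi₂ v : ℤ) : ℝ) / ((den v : ℤ) : ℝ)) ∧ g v z = 0} := by
  -- the first-order formula
  have h : (∅ : Set ℤ).Definable Language.ring {v : σ → ℤ | 0 < den v ∧ ∀ n : ℤ, 0 ≤ n → ∃ t : Fin 3 → ℤ,
      0 < t 2 ∧ (lo₁ v * t 2 ≤ t 0 * den v ∧ t 0 * den v ≤ hi₁ v * t 2 ∧ lo₂ v * t 2 ≤ t 1 * den v ∧
        t 1 * den v ≤ hi₂ v * t 2) ∧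
      g v ((((t 0 : ℤ) : ℂ) + ((t 1 : ℤ) : ℂ) * Complex.I) / ((t 2 : ℤ) : ℂ)) < ((1 : ℤ) : ℝ) / ((n + 1 : ℤ) : ℝ)} := by
    refine definable_setOf_and_params (ringDefinable_setOf_lt ringDefinableFun_zero hden)
      (definable_setOf_forall_params (definable_setOf_imp_params
        (ringDefinable_setOf_nonneg (definableFun_proj_params _))
        (definable_setOf_existsBlock (definable_setOf_and_params
          (ringDefinable_setOf_lt ringDefinableFun_zero (definableFun_proj_params _))
          (definable_setOf_and_params ?_ ?_)))))
    · have hl₁ := definableFun_reindex hlo₁ (fun s => (Sum.inl (Sum.inl s) : (σ ⊕ Unit) ⊕ Fin 3))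
      have hh₁ := definableFun_reindex hhi₁ (fun s => (Sum.inl (Sum.inl s) : (σ ⊕ Unit) ⊕ Fin 3))
      have hl₂ := definableFun_reindex hlo₂ (fun s => (Sum.inl (Sum.inl s) : (σ ⊕ Unit) ⊕ Fin 3))
      have hh₂ := definableFun_reindex hhi₂ (fun s => (Sum.inl (Sum.inl s) : (σ ⊕ Unit) ⊕ Fin 3))
      have hd := definableFun_reindex hden (fun s => (Sum.inl (Sum.inl s) : (σ ⊕ Unit) ⊕ Fin 3))
      exact definable_setOf_and_params
        (ringDefinable_setOf_le (ringDefinableFun_mul hl₁ (definableFun_proj_params _))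
          (ringDefinableFun_mul (definableFun_proj_params _) hd))
        (definable_setOf_and_params
        (ringDefinable_setOf_le (ringDefinableFun_mul (definableFun_proj_params _) hd)
          (ringDefinableFun_mul hh₁ (definableFun_proj_params _)))
        (definable_setOf_and_params
        (ringDefinable_setOf_le (ringDefinableFun_mul hl₂ (definableFun_proj_params _))
          (ringDefinableFun_mul (definableFun_proj_params _) hd))
        (ringDefinable_setOf_le (ringDefinableFun_mul (definableFun_proj_params _) hd)
          (ringDefinableFun_mul hh₂ (definableFun_proj_params _)))))
    · exact ringDefinable_setOf_realLt
        (defR_reindex hdef (Sum.elim (fun s => Sum.inl (Sum.inl s)) Sum.inr))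
        (defR_ratio ringDefinableFun_one (ringDefinableFun_add (definableFun_proj_params _) ringDefinableFun_one))
  convert h using 1
  ext v
  simp only [mem_setOf_eq]
  refine and_congr_right fun hden0 => ?_
  have hden' : (0 : ℝ) < den v := by exact_mod_cast hden0
  -- the box with rational corners
  have key := exists_zero_in_box_iff (hcont v) (hnn v) ((lo₁ v : ℚ) / den v) ((hi₁ v : ℚ) / den v)
    ((lo₂ v : ℚ) / den v) ((hi₂ v : ℚ) / den v)
  push_cast at key
  rw [key]
  constructor
  · intro H n hn
    obtain ⟨k, rfl⟩ := Int.eq_ofNat_of_zero_le hn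
    obtain ⟨q₁, q₂, ⟨h1, h2, h3, h4⟩, hlt⟩ := H k
    obtain ⟨a, b, c, hc, ha, hb⟩ := exists_int_triple_eq q₁ q₂
    have hc' : (0 : ℝ) < c := by exact_mod_cast hc
    have h1' : (lo₁ v : ℝ) / den v ≤ q₁ := by exact_mod_cast h1
    have h2' : (q₁ : ℝ) ≤ hi₁ v / den v := by exact_mod_cast h2
    have h3' : (lo₂ v : ℝ) / den v ≤ q₂ := by exact_mod_cast h3
    have h4' : (q₂ : ℝ) ≤ hi₂ v / den v := by exact_mod_cast h4
    rw [ha, div_le_div_iff₀ hden' hc'] at h1'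
    rw [ha, div_le_div_iff₀ hc' hden'] at h2'
    rw [hb, div_le_div_iff₀ hden' hc'] at h3'
    rw [hb, div_le_div_iff₀ hc' hden'] at h4'
    refine ⟨![a, b, c], hc, ⟨?_, ?_, ?_, ?_⟩, ?_⟩
    · simp only [Matrix.cons_val_zero, Matrix.cons_val]; exact_mod_cast h1'
    · simp only [Matrix.cons_val_zero, Matrix.cons_val]; exact_mod_cast h2'
    · simp only [Matrix.cons_val_one, Matrix.cons_val]; exact_mod_cast h3'
    · simp only [Matrix.cons_val_one, Matrix.cons_val]; exact_mod_cast h4'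
    · simp only [Matrix.cons_val_zero, Matrix.cons_val_one, Matrix.cons_val]
      rw [testPoint_eq, ← ha, ← hb]
      push_cast
      simpa using hlt
  · intro H k
    obtain ⟨t, ht2, ⟨h1, h2, h3, h4⟩, hlt⟩ := H k (Int.natCast_nonneg k)
    have ht2' : (0 : ℝ) < t 2 := by exact_mod_cast ht2
    refine ⟨(t 0 : ℚ) / t 2, (t 1 : ℚ) / t 2, ⟨?_, ?_, ?_, ?_⟩, ?_⟩
    · have : (lo₁ v : ℝ) * t 2 ≤ t 0 * den v := by exact_mod_cast h1
      have : (lo₁ v : ℝ) / den v ≤ t 0 / t 2 := by rw [div_le_div_iff₀ hden' ht2']; linarith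
      exact_mod_cast this
    · have : (t 0 : ℝ) * den v ≤ hi₁ v * t 2 := by exact_mod_cast h2
      have : (t 0 : ℝ) / t 2 ≤ hi₁ v / den v := by rw [div_le_div_iff₀ ht2' hden']; linarith
      exact_mod_cast this
    · have : (lo₂ v : ℝ) * t 2 ≤ t 1 * den v := by exact_mod_cast h3
      have : (lo₂ v : ℝ) / den v ≤ t 1 / t 2 := by rw [div_le_div_iff₀ hden' ht2']; linarith
      exact_mod_cast this
    · have : (t 1 : ℝ) * den v ≤ hi₂ v * t 2 := by exact_mod_cast h4
      have : (t 1 : ℝ) / t 2 ≤ hi₂ v / den v := by rw [div_le_div_iff₀ ht2' hden']; linarith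
      exact_mod_cast this
    · rw [testPoint_eq] at hlt
      push_cast at hlt ⊢
      simpa using hlt

/-! ## Registered form -/

omit [FirstOrder.Ring.CompatibleRing ℤ] in
/-- Registered helper stub `ringDefinable_existsZeroInBox_fin` of crux stmt-Schanuel-0969 (line kernel-arithmetic-selection, S8‴):
**"a continuous non-negative function has a zero in a closed rational box" is first-order over `ℤ`**: if the values `g_v((a+bi)/c)`
have a ring-definable strict lower rational cut in `(v, a, b, c, p, r)`, then `{(v, b) ∈ ℤ^k × ℤ⁵ : 0 < b₄ ∧ ∃ z ∈
[b₀/b₄, b₁/b₄] × [b₂/b₄, b₃/b₄], g_v z = 0}` is ring-definable (compactness + density of `ℚ[i]`). [folklore] -/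
theorem ringDefinable_existsZeroInBox_fin : ∀ [FirstOrder.Ring.CompatibleRing ℤ] (k : ℕ) (g : (Fin k → ℤ) → ℂ → ℝ), (∀ v, Continuous (g v)) → (∀ v z, 0 ≤ g v z) → (∅ : Set ℤ).Definable FirstOrder.Language.ring {w : (Fin k ⊕ Fin 3) ⊕ Fin 2 → ℤ | 0 < w (Sum.inr 1) ∧ ((w (Sum.inr 0) : ℤ) : ℝ) < ((w (Sum.inr 1) : ℤ) : ℝ) * g (fun s => w (Sum.inl (Sum.inl s))) ((((w (Sum.inl (Sum.inr 0)) : ℤ) : ℂ) + ((w (Sum.inl (Sum.inr 1)) : ℤ) : ℂ) * Complex.I) / ((w (Sum.inl (Sum.inr 2)) : ℤ) : ℂ))} → (∅ : Set ℤ).Definable FirstOrder.Language.ring {u : Fin k ⊕ Fin 5 → ℤ | 0 < u (Sum.inr 4) ∧ ∃ z : ℂ, ((((u (Sum.inr 0)) : ℤ) : ℝ) / (((u (Sum.inr 4)) : ℤ) : ℝ) ≤ z.re ∧ z.re ≤ (((u (Sum.inr 1)) : ℤ) : ℝ) / (((u (Sum.inr 4)) : ℤ) : ℝ) ∧ (((u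 (Sum.inr 2)) : ℤ) : ℝ) / (((u (Sum.inr 4)) : ℤ) : ℝ) ≤ z.im ∧ z.im ≤ (((u (Sum.inr 3)) : ℤ) : ℝ) / (((u (Sum.inr 4)) : ℤ) : ℝ)) ∧ g (fun s => u (Sum.inl s)) z = 0} := by
  intro _ k g hcont hnn hdef
  have hdef' : (∅ : Set ℤ).Definable Language.ring {w : _ ⊕ Fin 2 → ℤ | 0 < w (Sum.inr 1) ∧ ((w (Sum.inr 0) : ℤ) : ℝ) < ((w (Sum.inr 1) : ℤ) : ℝ) * ((fun w : Fin k ⊕ Fin 3 → ℤ => g (fun s => w (Sum.inl s))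
      ((((w (Sum.inr 0) : ℤ) : ℂ) + ((w (Sum.inr 1) : ℤ) : ℂ) * Complex.I) / ((w (Sum.inr 2) : ℤ) : ℂ))) ∘ fun w' s => w' (Sum.inl s)) w} := hdef
  exact ringDefinable_setOf_existsZeroInBox (σ := Fin k ⊕ Fin 5) (fun u z => g (fun s => u (Sum.inl s)) z)
    (fun u => hcont _) (fun u z => hnn _ z) (defR_reindex hdef' (Sum.map Sum.inl id))
    (definableFun_proj_params (Sum.inr 0)) (definableFun_proj_params (Sum.inr 1))
    (definableFun_proj_params (Sum.inr 2)) (definableFun_proj_params (Sum.inr 3)) (definableFun_proj_params (Sum.inr 4))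

end Summit.Schanuel.Schanuel.Cruxes.MinimalCounterexampleInAcl.KernelArithmeticSelection
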